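import Summits.ABC.IUTFork.Conditional.AbcOfSHregBadSzpiroGuardSUnit
import HarnessLib

/-!
# Every CUT of the (U)-line cone binder is false modulo one mixed witness IN the cut — and the S-unit family supplies the witness
# (plan RULING C-R42 «C:SZPIRO-GUARD-SUNIT», generic form for `hregBad` / `hregC` / any future antecedent)

Record-only PROOF file (D-0012) of the abc-iut cell (R2 S-chain team, seat abc-iut-s2-p4 gen 5); TAKES NO SIDE on [IUTchIII] Cor. 3.12,
on [IUTchIV] Thm. 1.10, or on any author. S. Mochizuki, *IUT IV* [Mochizuki2012], Thm. 1.10 proof Steps (v)–(viii) pp. 27–31; Cor. 2.2 (ii)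
proof (P1)–(P7) pp. 45–46; cell note plan/c312/STEPV-IND1-NOTE.md (reading (U)).

The certificates of record cut the cone binder `hreg` by an ANTECEDENT `X(P, l)`: `hregBad` (Szpiro-bad disjunct; p452637 / p453137) and, since
C-R47, `hregC` (the display-CONTENT guard `6(1 + 20·d_mod/l)(log-diff + log-cond) + 120·d*_mod·l < log q^{∤{2,l}}`; record K p460293,
θ-companion p459802). abc-iut-s2-p5's `Negative.hregBad_false_of_szpiroBadMixedWitness` (p457414) is the negative-modulo lemma for the FIRST cut;
its proof never looks at the antecedent. THIS FILE states it once for an ARBITRARY antecedent `X : NFPoint → ℕ → Prop` and lets the S-unit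
family `P_{a,c}` of this lineage (parts I–V, `Conditional/AbcOfSHregBadSzpiroGuardSUnit`) supply the witness:
* `Conditional.hregCut_false_of_mixedWitness` — for ANY `X`: one admissible `(P, l)` with `X(P, l)`, `4·d_mod ≤ l+5`, a mixed pair and a set
  `W₀` at which abc-iut-s2-p1's sharp slack is STRICTLY below the mixed-height sum kills the `X`-cut cone binder (text of `hregBad` with the
  Szpiro-bad line replaced by `X P l`; proof = p457414's, by `ThetaPartII.stub_thetaData`, `not_slotConstant_of_unequalHeightsPoint`,
  `PointDict.pointMixedShare_le_sub_gain_of_hullEstimateOf`);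
* `SUnitFamily.exists_mixedWitness_of_members` — for a prime `l ≥ 173` and ANY `X`: if the family has members `(P_{a,c}, l)` IN the cut
  (`X(P_{a,c}, l)`) with `a` unbounded (`l ∤ a, c`, `7^c ≤ 5^a ≤ 5^l·7^c`), the witness tuple EXISTS (admissibility parts II–IV, (P6) by
  `Cor22.condP6_of_seven_le`, mixed pair `(𝔭₁, 𝔭₂)` over `5`, `W₀ = {5}`, strict violation `SUnitFamily.slack_lt_mixed`);
* **`Conditional.not_hregCut_of_sUnitFamily`** — hence for ANY cut `X`: members in the cut of unbounded height ⟹ the `X`-cut cone binder is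
  FALSE; contrapositive **`Conditional.eventually_not_cut_of_hregCut`**: the `X`-cut binder implies that NO large member of the family lies in
  the cut. With `X` = Szpiro-bad this is p465518; with `X` = the content guard it is `Conditional/AbcOfSHregContentGuardSUnit.lean`.
HONEST READING: a cut rescues the cone binder from this family exactly to the extent that the cut EXCLUDES all large members `P_{a,c}` — for
the two cuts of record that exclusion is an abc-type statement about `5^{2a} + 4·7^{2c}` (part V / the content sequel), neither provable nor
refutable in the tree. Nothing asserted about Θ-data; antecedents not asserted; no side taken; refuted-as-typed ≠ refuted-in-print; typed ≠
proved. PROOF-ONLY file: no definitions, no named `Prop` facts.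
[cite: Mochizuki2012, IUTchIV Thm. 1.10 proof Steps (v)-(viii) p. 27–31] [cite: Mochizuki2012, IUTchIV Cor. 2.2 (ii) proof (P1)-(P7) pp. 45–46]
[cite: DupuyHilado2025, §3.3, §3.6, §4.7, §4.12] [claim: Mochizuki2012, status: disputed] for every IUT quotation.
-/

noncomputable section

namespace Summit.ABC.IUTFork

open NumberField IsDedekindDomain Literature.IUT.LogVolume Literature.IUT.LogVolume.Cor22 Literature.IUT.HodgeTheaters
open Literature.NumberTheory.DiophantineGeometry.GenEll Literature.NumberTheory.NumberFields
open scoped Classical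

namespace Conditional

/-- The sharp slack IS `B_III` minus the different gain (real identity; abc-iut-s2-p1's `le_slack_of_add_gain_le`). [folklore] -/
private theorem BIII_sub_gain_eq {l d lD lC R : ℝ} (hl : 0 < l) :
    (l + 1) / 4 * ((1 + 12 * d / l) * (lD + lC) + R) - ((l + 5) / 4 - d) * (lD + (1 - 1 / l) * lC) =
      (4 * d - 1 + 3 * d / l) * (lD + lC) + (l + 5 - 4 * d) / (4 * l) * lC + (l + 1) / 4 * R := by
  field_simp
  ring

/-- **EVERY CUT OF THE CONE BINDER IS FALSE MODULO ONE MIXED WITNESS IN THE CUT.** For ANY antecedent `X : NFPoint → ℕ → Prop`: if some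
admissible `(P, l)` (`P ∈ UP`, `l ≥ 5` prime, a core, (P2), (P5), (P6)) satisfies `X P l`, has `4·d_mod ≤ l + 5`, carries places `V, W` of
`F_tpd` over one prime `p₀` with `V ∈ 𝕍^bad_{∤2l}` and (`W ∉ 𝕍^bad_{∤2l}` or a different normalised local height), and a finite set `W₀` of
primes (each under a non-(P5)-bad place of `ℚ(j(λ))` of positive weight) at which abc-iut-s2-p1's sharp slack is STRICTLY below the mixed-height
sum, THEN the `X`-cut cone binder (the text of `hregBad` — abc-iut-s2-p2 p452755 — with its Szpiro-bad line replaced by `X P l`) fails. The proof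
is abc-iut-s2-p5's (p457414, the case `X` = Szpiro-bad), which never inspects the antecedent: datum by `ThetaPartII.stub_thetaData`,
non-slot-constancy by `not_slotConstant_of_unequalHeightsPoint`, «mixed sum ≤ B_III − gain = slack» by
`PointDict.pointMixedShare_le_sub_gain_of_hullEstimateOf`. An implication; its antecedent is NOT asserted.
[cite: Mochizuki2012, IUTchIV Thm. 1.10 Steps (v)–(viii) p. 27–31] [claim: Mochizuki2012, status: disputed] -/
theorem hregCut_false_of_mixedWitness {X : NFPoint → ℕ → Prop}
    (H : ∃ (P : NFPoint) (_ : P ∈ UP) (l : ℕ) (_ : l.Prime) (_ : 5 ≤ l) (_ : Cor22.AdmitsCore P)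
        (_ : Cor22.CondP2 P l) (_ : Cor22.CondP5 P l) (_ : Cor22.CondP6 P l) (_ : X P l)
        (_ : 4 * (Cor22.dmod P : ℝ) ≤ (l : ℝ) + 5)
        (p₀ : ℕ) (_ : p₀.Prime) (V W : HeightOneSpectrum (𝓞 P.F)) (_ : V ∈ placesOver P.F p₀) (_ : W ∈ placesOver P.F p₀)
        (_ : V ∈ Cor22.badPlacesAvoid P {2, l})
        (_ : W ∈ Cor22.badPlacesAvoid P {2, l} →
          (ord P.F V (Cor22.jInv P.x) : ℝ) * logNorm P.F V / (localDegree P.F V : ℝ) ≠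
            (ord P.F W (Cor22.jInv P.x) : ℝ) * logNorm P.F W / (localDegree P.F W : ℝ))
        (W₀ : Finset ℕ) (_ : ∀ p ∈ W₀, p.Prime)
        (_ : ∀ p ∈ W₀, 0 < ∑ U ∈ Finset.univ.filter
            (fun U : placesOver ↥(IntermediateField.adjoin ℚ ({Cor22.jInv P.x} : Set P.F)) p =>
              ¬ (ord _ U.1 (Cor22.jMod P) < 0 ∧ ((2 : ℕ) : 𝓞 _) ∉ U.1.asIdeal ∧ ((l : ℕ) : 𝓞 _) ∉ U.1.asIdeal)),
            weight _ U.1),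
        (4 * (Cor22.dmod P : ℝ) - 1 + 3 * (Cor22.dmod P : ℝ) / l) * (P.logDiff + Cor22.logCondAvoid P {2, l})
            + ((l : ℝ) + 5 - 4 * (Cor22.dmod P : ℝ)) / (4 * (l : ℝ)) * Cor22.logCondAvoid P {2, l}
            + ((l : ℝ) + 1) / 4 * (2 * Real.log l + 52
              + 20 / 3 * Real.log (((2 ^ 12 * 3 ^ 3 * 5 * Cor22.dmod P : ℕ) : ℝ) * (l : ℝ))
                * (Nat.primeCounting (2 ^ 12 * 3 ^ 3 * 5 * Cor22.dmod P * l) : ℝ)) <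
          ∑ p ∈ W₀, (1 / (2 * (l : ℝ)) *
            ∑ U : placesOver ↥(IntermediateField.adjoin ℚ ({Cor22.jInv P.x} : Set P.F)) p,
              (if ord _ U.1 (Cor22.jMod P) < 0 ∧ ((2 : ℕ) : 𝓞 _) ∉ U.1.asIdeal ∧ ((l : ℕ) : 𝓞 _) ∉ U.1.asIdeal then
                weight _ U.1 * (((-ord _ U.1 (Cor22.jMod P) : ℤ) : ℝ) * logNorm _ U.1 / (localDegree _ U.1 : ℝ))
               else 0)) *
            ((l : ℝ) * ((l : ℝ) + 1) / 12
              - 4 * (1 - ∑ U ∈ Finset.univ.filter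
                    (fun U : placesOver ↥(IntermediateField.adjoin ℚ ({Cor22.jInv P.x} : Set P.F)) p =>
                      ¬ (ord _ U.1 (Cor22.jMod P) < 0 ∧ ((2 : ℕ) : 𝓞 _) ∉ U.1.asIdeal ∧ ((l : ℕ) : 𝓞 _) ∉ U.1.asIdeal)),
                    weight _ U.1) /
                (((l : ℝ) - 1) * (∑ U ∈ Finset.univ.filter
                    (fun U : placesOver ↥(IntermediateField.adjoin ℚ ({Cor22.jInv P.x} : Set P.F)) p =>
                      ¬ (ord _ U.1 (Cor22.jMod P) < 0 ∧ ((2 : ℕ) : 𝓞 _) ∉ U.1.asIdeal ∧ ((l : ℕ) : 𝓞 _) ∉ U.1.asIdeal)),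
                    weight _ U.1) ^ 3))) :
    ¬ (∀ P : NFPoint, P ∈ UP → ∀ l : ℕ, l.Prime → 5 ≤ l →
      Cor22.AdmitsCore P → Cor22.CondP2 P l → Cor22.CondP5 P l → Cor22.CondP6 P l → X P l →
      ∀ T : Cor22.ThetaVolumeDatumAt P l,
        (letI := T.instFieldF; letI := T.instNumberFieldF; letI := T.instAlgebraF; letI := T.instFieldK
         letI := T.instNumberFieldK; letI := T.instAlgebraK; letI := T.instFieldFbar; letI := T.instAlgebraFbar
         letI := T.instAlgebraKFbar; letI := T.instIsElliptic
         ¬ (∀ p ∈ T.I.supportPrimes, ∀ v w : placesOver (fieldOfModuli T.E) p,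
            (Summit.ABC.IUTFork.DHData.ofInput T.I).logQloc p v = (Summit.ABC.IUTFork.DHData.ofInput T.I).logQloc p w)) →
        T.HullEstimateOf
          (((l : ℝ) + 1) / 4 *
            ((1 + 12 * (Cor22.dmod P : ℝ) / l) * (P.logDiff + Cor22.logCondAvoid P {2, l})
              + 2 * Real.log l + 52
              + 20 / 3 * Real.log (((2 ^ 12 * 3 ^ 3 * 5 * Cor22.dmod P : ℕ) : ℝ) * (l : ℝ))
                * (Nat.primeCounting (2 ^ 12 * 3 ^ 3 * 5 * Cor22.dmod P * l) : ℝ)))) := by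
  intro hcut
  obtain ⟨P, hP, l, hl, h5, hcore, h2, h5', h6, hX, h4d, p₀, hp₀, V, W, hV, hW, hVb, hne, W₀, hW₀, hω, hlt⟩ := H
  haveI : Fact p₀.Prime := ⟨hp₀⟩
  obtain ⟨T⟩ := Summit.ABC.ABC.Theorems.ThetaPartII.stub_thetaData P hP l hl h5 hcore h2 h5' h6
  have hns := PointDict.not_slotConstant_of_unequalHeightsPoint T hV hW hVb hne
  have hT := hcut P hP l hl h5 hcore h2 h5' h6 hX T hns
  have hmix := PointDict.pointMixedShare_le_sub_gain_of_hullEstimateOf T hT hl.pos h4d W₀ hW₀ hω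
  have hl0 : (0 : ℝ) < (l : ℝ) := by exact_mod_cast hl.pos
  have key := BIII_sub_gain_eq (d := (Cor22.dmod P : ℝ)) (lD := P.logDiff) (lC := Cor22.logCondAvoid P {2, l})
    (R := 2 * Real.log l + 52
      + 20 / 3 * Real.log (((2 ^ 12 * 3 ^ 3 * 5 * Cor22.dmod P : ℕ) : ℝ) * (l : ℝ))
        * (Nat.primeCounting (2 ^ 12 * 3 ^ 3 * 5 * Cor22.dmod P * l) : ℝ)) hl0
  have e : ((l : ℝ) + 1) / 4 *
        ((1 + 12 * (Cor22.dmod P : ℝ) / l) * (P.logDiff + Cor22.logCondAvoid P {2, l})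
          + 2 * Real.log l + 52
          + 20 / 3 * Real.log (((2 ^ 12 * 3 ^ 3 * 5 * Cor22.dmod P : ℕ) : ℝ) * (l : ℝ))
            * (Nat.primeCounting (2 ^ 12 * 3 ^ 3 * 5 * Cor22.dmod P * l) : ℝ)) =
      ((l : ℝ) + 1) / 4 *
        ((1 + 12 * (Cor22.dmod P : ℝ) / l) * (P.logDiff + Cor22.logCondAvoid P {2, l})
          + (2 * Real.log l + 52
            + 20 / 3 * Real.log (((2 ^ 12 * 3 ^ 3 * 5 * Cor22.dmod P : ℕ) : ℝ) * (l : ℝ))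
              * (Nat.primeCounting (2 ^ 12 * 3 ^ 3 * 5 * Cor22.dmod P * l) : ℝ))) := by ring
  rw [e] at hmix
  linarith

end Conditional

namespace SUnitFamily

/-- **THE S-UNIT FAMILY SUPPLIES THE WITNESS FOR ANY CUT IT MEETS UNBOUNDEDLY.** For a prime `l ≥ 173` and ANY antecedent `X`: if for every `N`
there are `a ≥ N`, `c` with `l ∤ a`, `l ∤ c`, `7^c ≤ 5^a ≤ 5^l·7^c` and `X(P_{a,c}, l)`, then the witness tuple of
`Conditional.hregCut_false_of_mixedWitness` exists: `P_{a,c} ∈ U_P` minimal, a core, (P2) (`l ∤ 2a, 2c`), (P5), (P6) above a height on `K_∞(5^l)`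
(`Cor22.condP6_of_seven_le`), `d_mod = 2 ≤ (l+5)/4`, the mixed pair `(𝔭₁, 𝔭₂)` over `5`, `W₀ = {5}` (`ω₅ = ½`, mixed sum `a·log 5`) and the STRICT
violation `slack_lt_mixed` for `a·log 5 > K(l)` (parts II–V of this lineage; the construction of p465518 with the antecedent abstracted).
[cite: Mochizuki2012, IUTchIV Cor. 2.2 (ii) proof (P1)-(P7) pp. 45–46] [claim: Mochizuki2012, status: disputed] -/
theorem exists_mixedWitness_of_members {X : NFPoint → ℕ → Prop} {l : ℕ} (hl : l.Prime) (h173 : 173 ≤ l)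
    (H : ∀ N : ℕ, ∃ a c : ℕ, N ≤ a ∧ ¬ l ∣ a ∧ ¬ l ∣ c ∧ 7 ^ c ≤ 5 ^ a ∧ 5 ^ a ≤ 5 ^ l * 7 ^ c ∧ X (Pt a c) l) :
    ∃ (P : NFPoint) (_ : P ∈ UP) (l : ℕ) (_ : l.Prime) (_ : 5 ≤ l) (_ : Cor22.AdmitsCore P)
        (_ : Cor22.CondP2 P l) (_ : Cor22.CondP5 P l) (_ : Cor22.CondP6 P l) (_ : X P l)
        (_ : 4 * (Cor22.dmod P : ℝ) ≤ (l : ℝ) + 5)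
        (p₀ : ℕ) (_ : p₀.Prime) (V W : HeightOneSpectrum (𝓞 P.F)) (_ : V ∈ placesOver P.F p₀) (_ : W ∈ placesOver P.F p₀)
        (_ : V ∈ Cor22.badPlacesAvoid P {2, l})
        (_ : W ∈ Cor22.badPlacesAvoid P {2, l} →
          (ord P.F V (Cor22.jInv P.x) : ℝ) * logNorm P.F V / (localDegree P.F V : ℝ) ≠
            (ord P.F W (Cor22.jInv P.x) : ℝ) * logNorm P.F W / (localDegree P.F W : ℝ))
        (W₀ : Finset ℕ) (_ : ∀ p ∈ W₀, p.Prime)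
        (_ : ∀ p ∈ W₀, 0 < ∑ U ∈ Finset.univ.filter
            (fun U : placesOver ↥(IntermediateField.adjoin ℚ ({Cor22.jInv P.x} : Set P.F)) p =>
              ¬ (ord _ U.1 (Cor22.jMod P) < 0 ∧ ((2 : ℕ) : 𝓞 _) ∉ U.1.asIdeal ∧ ((l : ℕ) : 𝓞 _) ∉ U.1.asIdeal)),
            weight _ U.1),
        (4 * (Cor22.dmod P : ℝ) - 1 + 3 * (Cor22.dmod P : ℝ) / l) * (P.logDiff + Cor22.logCondAvoid P {2, l})
            + ((l : ℝ) + 5 - 4 * (Cor22.dmod P : ℝ)) / (4 * (l : ℝ)) * Cor22.logCondAvoid P {2, l}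
            + ((l : ℝ) + 1) / 4 * (2 * Real.log l + 52
              + 20 / 3 * Real.log (((2 ^ 12 * 3 ^ 3 * 5 * Cor22.dmod P : ℕ) : ℝ) * (l : ℝ))
                * (Nat.primeCounting (2 ^ 12 * 3 ^ 3 * 5 * Cor22.dmod P * l) : ℝ)) <
          ∑ p ∈ W₀, (1 / (2 * (l : ℝ)) *
            ∑ U : placesOver ↥(IntermediateField.adjoin ℚ ({Cor22.jInv P.x} : Set P.F)) p,
              (if ord _ U.1 (Cor22.jMod P) < 0 ∧ ((2 : ℕ) : 𝓞 _) ∉ U.1.asIdeal ∧ ((l : ℕ) : 𝓞 _) ∉ U.1.asIdeal then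
                weight _ U.1 * (((-ord _ U.1 (Cor22.jMod P) : ℤ) : ℝ) * logNorm _ U.1 / (localDegree _ U.1 : ℝ))
               else 0)) *
            ((l : ℝ) * ((l : ℝ) + 1) / 12
              - 4 * (1 - ∑ U ∈ Finset.univ.filter
                    (fun U : placesOver ↥(IntermediateField.adjoin ℚ ({Cor22.jInv P.x} : Set P.F)) p =>
                      ¬ (ord _ U.1 (Cor22.jMod P) < 0 ∧ ((2 : ℕ) : 𝓞 _) ∉ U.1.asIdeal ∧ ((l : ℕ) : 𝓞 _) ∉ U.1.asIdeal)),
                    weight _ U.1) /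
                (((l : ℝ) - 1) * (∑ U ∈ Finset.univ.filter
                    (fun U : placesOver ↥(IntermediateField.adjoin ℚ ({Cor22.jInv P.x} : Set P.F)) p =>
                      ¬ (ord _ U.1 (Cor22.jMod P) < 0 ∧ ((2 : ℕ) : 𝓞 _) ∉ U.1.asIdeal ∧ ((l : ℕ) : 𝓞 _) ∉ U.1.asIdeal)),
                    weight _ U.1) ^ 3)) := by
  haveI : Fact (Nat.Prime 5) := ⟨by norm_num⟩
  have hl2 : 2 ≤ l := hl.two_le
  have hl5 : l ≠ 5 := by omega
  have hlne2 : l ≠ 2 := by omega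
  have hl7 : 7 ≤ l := by omega
  have hlr : (173 : ℝ) ≤ (l : ℝ) := by exact_mod_cast h173
  have hl0 : (0 : ℝ) < (l : ℝ) := by linarith
  set R : ℝ := (5 : ℝ) ^ l with hRdef
  have hR : 1 ≤ R := one_le_pow₀ (by norm_num)
  obtain ⟨HK, hHK⟩ := Cor22.condP6_of_seven_le (cbTwoDiscs R hR)
  set E : ℝ := 2 * Real.log l + 52 + 20 / 3 * Real.log (1105920 * (l : ℝ)) * ((1105920 * l).primeCounting : ℝ) with hEdef
  set K : ℝ := 5 * (8 * ((Real.log 5 + 2 * Real.log 7) / 2) + 8 * (Real.log 5 / 2) + ((l : ℝ) + 1) / 4 * E) with hKdef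
  have hlog5 : 0 < Real.log 5 := Real.log_pos (by norm_num)
  obtain ⟨n, hn⟩ := exists_nat_gt (max HK K / Real.log 5)
  obtain ⟨a, c, hNa, hla, hlc, hlo, hhi, hX⟩ := H (n + l + 1)
  have ha1 : 1 ≤ a := by omega
  have hc1 : 1 ≤ c := by
    by_contra h0
    have hc0 : c = 0 := by omega
    rw [hc0, pow_zero, mul_one] at hhi
    have := (Nat.pow_le_pow_iff_right (by norm_num : 1 < 5)).mp hhi
    omega
  have hbig : max HK K < (a : ℝ) * Real.log 5 := by
    have h1 : max HK K < (n : ℝ) * Real.log 5 := by rwa [div_lt_iff₀ hlog5] at hn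
    have h2 : (n : ℝ) * Real.log 5 ≤ (a : ℝ) * Real.log 5 :=
      mul_le_mul_of_nonneg_right (by exact_mod_cast (by omega : n ≤ a)) hlog5.le
    linarith
  have hP : Pt a c ∈ UP := P_mem_UP ha1 hc1
  have hcore : Cor22.AdmitsCore (Pt a c) := admitsCore_P ha1 hc1
  have h2 : Cor22.CondP2 (Pt a c) l := condP2_P ha1 hc1 hl hlne2 hla hlc
  have h5 : Cor22.CondP5 (Pt a c) l := condP5_P ha1 hc1 hl hl5
  have hd : Cor22.dmod (Pt a c) = 2 := dmod_P ha1 hc1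
  have hmem : Pt a c ∈ (cbTwoDiscs R hR).toSet :=
    P_mem_cbTwoDiscs (a := a) (c := c) hR (by exact_mod_cast hlo) (by rw [hRdef]; exact_mod_cast hhi)
  have hq : (a : ℝ) * Real.log 5 ≤ Cor22.logQForall (Pt a c) := le_logQForall_P ha1 hc1
  have hHK' : HK < Cor22.logQForall (Pt a c) := by linarith [le_max_left HK K]
  have h6 : Cor22.CondP6 (Pt a c) l := hHK (Pt a c) hmem hP l hl hl7 h2 h5 hHK'
  have h4d : 4 * (Cor22.dmod (Pt a c) : ℝ) ≤ (l : ℝ) + 5 := by rw [hd]; push_cast; linarith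
  obtain ⟨𝔭₁, 𝔭₂, -, -, ⟨k1, k1', k15, ko1⟩, ⟨k2, -, k25, -⟩, -, -⟩ := exists_four_places ha1 hc1
  have hv1 : 𝔭₁ ∈ placesOver (Pt a c).F 5 := Cor22.mem_placesOver_of_natCast_mem 5 𝔭₁ k15
  have hv2 : 𝔭₂ ∈ placesOver (Pt a c).F 5 := Cor22.mem_placesOver_of_natCast_mem 5 𝔭₂ k25
  have hord1 : ord (Pt a c).F 𝔭₁ (Cor22.jInv (Pt a c).x) = -(2 * (a : ℤ)) := (ord_at_p1 hc1 k15 k1 k1' ko1).1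
  have hord2 : 0 ≤ ord (Pt a c).F 𝔭₂ (Cor22.jInv (Pt a c).x) := (ord_at_p2 hc1 k25 k2).1
  have hV : 𝔭₁ ∈ Cor22.badPlacesAvoid (Pt a c) {2, l} := by
    unfold Cor22.badPlacesAvoid
    rw [Finset.mem_filter, Cor22.mem_badPlaces_iff_ord_neg]
    refine ⟨by rw [hord1]; omega, fun p hp => ?_⟩
    simp only [Finset.mem_insert, Finset.mem_singleton] at hp
    rcases hp with rfl | rfl
    · exact SplitDepth.natCast_not_mem_of_prime_ne ⟨𝔭₁, hv1⟩ Nat.prime_two (by norm_num)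
    · exact SplitDepth.natCast_not_mem_of_prime_ne ⟨𝔭₁, hv1⟩ hl hl5
  have hW : 𝔭₂ ∈ Cor22.badPlacesAvoid (Pt a c) {2, l} →
      (ord (Pt a c).F 𝔭₁ (Cor22.jInv (Pt a c).x) : ℝ) * logNorm (Pt a c).F 𝔭₁ / (localDegree (Pt a c).F 𝔭₁ : ℝ) ≠
        (ord (Pt a c).F 𝔭₂ (Cor22.jInv (Pt a c).x) : ℝ) * logNorm (Pt a c).F 𝔭₂ / (localDegree (Pt a c).F 𝔭₂ : ℝ) := by
    intro h
    exfalso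
    unfold Cor22.badPlacesAvoid at h
    rw [Finset.mem_filter, Cor22.mem_badPlaces_iff_ord_neg] at h
    exact absurd hord2 (not_le.mpr h.1)
  obtain ⟨hω, hsum⟩ := mixed_data_at_five ha1 hc1 hl hl5
  have hω' : ∀ p ∈ ({5} : Finset ℕ), 0 < ∑ V ∈ Finset.univ.filter
      (fun V : placesOver ↥(IntermediateField.adjoin ℚ ({Cor22.jInv (Pt a c).x} : Set (Pt a c).F)) p =>
        ¬ (ord _ V.1 (Cor22.jMod (Pt a c)) < 0 ∧ ((2 : ℕ) : 𝓞 _) ∉ V.1.asIdeal ∧ ((l : ℕ) : 𝓞 _) ∉ V.1.asIdeal)),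
      weight _ V.1 := by
    intro p hp
    rw [Finset.mem_singleton] at hp
    subst hp
    rw [hω]; norm_num
  refine ⟨Pt a c, hP, l, hl, by omega, hcore, h2, h5, h6, hX, h4d, 5, Nat.prime_five, 𝔭₁, 𝔭₂, hv1, hv2, hV, hW,
    {5}, fun p hp => by rw [Finset.mem_singleton] at hp; subst hp; exact Nat.prime_five, hω', ?_⟩
  rw [Finset.sum_singleton, hsum, hω, hd]
  push_cast
  have hK : K < (a : ℝ) * Real.log 5 := lt_of_le_of_lt (le_max_right HK K) hbig
  have hm := slack_lt_mixed h173 (E := E) (NFPoint.logDiff_nonneg (Pt a c)) (Cor22.logCondAvoid_nonneg (Pt a c) {2, l})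
    (logDiff_le_linear hlo) (logCondAvoid_le ha1 hc1 {2, l}) (by rw [hKdef] at hK; exact hK)
  rw [hEdef] at hm
  convert hm using 2

end SUnitFamily

namespace Conditional

/-- **FOR ANY CUT `X`: MEMBERS OF THE S-UNIT FAMILY IN THE CUT, OF UNBOUNDED HEIGHT, KILL THE `X`-CUT CONE BINDER** (prime `l ≥ 173`;
`hregCut_false_of_mixedWitness` ∘ `SUnitFamily.exists_mixedWitness_of_members`). `X` = Szpiro-bad: p465518; `X` = content guard: the sequel.
The antecedent is NOT asserted. [cite: Mochizuki2012, IUTchIV Thm. 1.10 Steps (v)–(viii) p. 27–31] [claim: Mochizuki2012, status: disputed] -/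
theorem not_hregCut_of_sUnitFamily {X : NFPoint → ℕ → Prop} {l : ℕ} (hl : l.Prime) (h173 : 173 ≤ l)
    (H : ∀ N : ℕ, ∃ a c : ℕ, N ≤ a ∧ ¬ l ∣ a ∧ ¬ l ∣ c ∧ 7 ^ c ≤ 5 ^ a ∧ 5 ^ a ≤ 5 ^ l * 7 ^ c ∧ X (SUnitFamily.Pt a c) l) :
    ¬ (∀ P : NFPoint, P ∈ UP → ∀ l : ℕ, l.Prime → 5 ≤ l →
      Cor22.AdmitsCore P → Cor22.CondP2 P l → Cor22.CondP5 P l → Cor22.CondP6 P l → X P l →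
      ∀ T : Cor22.ThetaVolumeDatumAt P l,
        (letI := T.instFieldF; letI := T.instNumberFieldF; letI := T.instAlgebraF; letI := T.instFieldK
         letI := T.instNumberFieldK; letI := T.instAlgebraK; letI := T.instFieldFbar; letI := T.instAlgebraFbar
         letI := T.instAlgebraKFbar; letI := T.instIsElliptic
         ¬ (∀ p ∈ T.I.supportPrimes, ∀ v w : placesOver (fieldOfModuli T.E) p,
            (Summit.ABC.IUTFork.DHData.ofInput T.I).logQloc p v = (Summit.ABC.IUTFork.DHData.ofInput T.I).logQloc p w)) →
        T.HullEstimateOf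
          (((l : ℝ) + 1) / 4 *
            ((1 + 12 * (Cor22.dmod P : ℝ) / l) * (P.logDiff + Cor22.logCondAvoid P {2, l})
              + 2 * Real.log l + 52
              + 20 / 3 * Real.log (((2 ^ 12 * 3 ^ 3 * 5 * Cor22.dmod P : ℕ) : ℝ) * (l : ℝ))
                * (Nat.primeCounting (2 ^ 12 * 3 ^ 3 * 5 * Cor22.dmod P * l) : ℝ)))) :=
  hregCut_false_of_mixedWitness (SUnitFamily.exists_mixedWitness_of_members hl h173 H)

/-- **THE `X`-CUT BINDER EXCLUDES ALL LARGE MEMBERS OF THE FAMILY FROM THE CUT** (contrapositive of `not_hregCut_of_sUnitFamily`): if the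
`X`-cut cone binder holds then beyond some `N` no `(P_{a,c}, l)` (`a ≥ N`, `l ∤ a, c`, `7^c ≤ 5^a ≤ 5^l·7^c`) satisfies `X` — a cut rescues the
binder from this family exactly as far as it excludes the family's tail. Nothing asserted about either side.
[cite: Mochizuki2012, IUTchIV Thm. 1.10 Steps (v)–(viii) p. 27–31] [claim: Mochizuki2012, status: disputed] -/
theorem eventually_not_cut_of_hregCut {X : NFPoint → ℕ → Prop} {l : ℕ} (hl : l.Prime) (h173 : 173 ≤ l)
    (hcut : ∀ P : NFPoint, P ∈ UP → ∀ l : ℕ, l.Prime → 5 ≤ l →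
      Cor22.AdmitsCore P → Cor22.CondP2 P l → Cor22.CondP5 P l → Cor22.CondP6 P l → X P l →
      ∀ T : Cor22.ThetaVolumeDatumAt P l,
        (letI := T.instFieldF; letI := T.instNumberFieldF; letI := T.instAlgebraF; letI := T.instFieldK
         letI := T.instNumberFieldK; letI := T.instAlgebraK; letI := T.instFieldFbar; letI := T.instAlgebraFbar
         letI := T.instAlgebraKFbar; letI := T.instIsElliptic
         ¬ (∀ p ∈ T.I.supportPrimes, ∀ v w : placesOver (fieldOfModuli T.E) p,
            (Summit.ABC.IUTFork.DHData.ofInput T.I).logQloc p v = (Summit.ABC.IUTFork.DHData.ofInput T.I).logQloc p w)) →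
        T.HullEstimateOf
          (((l : ℝ) + 1) / 4 *
            ((1 + 12 * (Cor22.dmod P : ℝ) / l) * (P.logDiff + Cor22.logCondAvoid P {2, l})
              + 2 * Real.log l + 52
              + 20 / 3 * Real.log (((2 ^ 12 * 3 ^ 3 * 5 * Cor22.dmod P : ℕ) : ℝ) * (l : ℝ))
                * (Nat.primeCounting (2 ^ 12 * 3 ^ 3 * 5 * Cor22.dmod P * l) : ℝ)))) :
    ∃ N : ℕ, ∀ a c : ℕ, N ≤ a → ¬ l ∣ a → ¬ l ∣ c → 7 ^ c ≤ 5 ^ a → 5 ^ a ≤ 5 ^ l * 7 ^ c → ¬ X (SUnitFamily.Pt a c) l := by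
  by_contra hne
  push Not at hne
  exact not_hregCut_of_sUnitFamily hl h173 hne hcut

end Conditional

end Summit.ABC.IUTFork

end
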